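import Summits.CriticalPhenomena.Ising3DConformalLimit.Theorems.SynchronousCouplingRotationJoiningIsotropyDefs
import Summits.CriticalPhenomena.Ising3DConformalLimit.Theorems.HyperoctahedralRPExistsScaleCovariantLimitBlockCovAlgebra
import HarnessLib

/-!
# Route `SynchronousCoupling`, crux `RotationJoining` (stmt-CriticalPhenomena-18763), line `SketchIdeator2` (reshape 2) —
# two-point row sums in a window and near a point (lead's tools for the near-field control of `stub_isotropyTransfer`)

From `BallSums` (ball sums `L³ Σ_{‖z‖_∞ ≤ cL} ⟨σ₀σ_z⟩ ≤ A V(L)`, in tree) and the super-cubic growth of the block variance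
(`TwoPointToolkit` (b): `V(ℓ) L^{7/2} ≤ A ℓ^{7/2} V(L)`):
* `rowSum_window_le` — for `n ≥ L₀` and sites `q` within sup-distance `2cn` of `p`: `Σ_q ⟨σ_pσ_q⟩ ≤ A V(n)/n³`;
* `rowSum_near_le` — for `L₀ ≤ L' ≤ n` and sites `q` within `L'` of `p`: `Σ_q ⟨σ_pσ_q⟩ ≤ A' √L' · n^{-7/2} · V(n)`
  (so a ball of radius `≈ rn` carries only `O(√r)` of the row sum `V(n)/n³`);
* `pairSum_window_le` — `Σ_{x ∈ Q, y ∈ Q'} ⟨σ_xσ_y⟩ ≤ |Q| · A V(n)/n³` for cells inside the window.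
References: A. Messager, S. Miracle-Solé, J. Stat. Phys. 17 (1977) (monotonicity behind the ball sums); M. Aizenman,
H. Duminil-Copin, Ann. Math. 194 (2021) §5 (regular growth of two-point sums). No definitions, no sorry.
-/

noncomputable section

namespace Summit.CriticalPhenomena.Ising3DConformalLimit.Cruxes.RotationJoining.RateSplitting

open Literature.Probability.LatticeModels Finset
open scoped BigOperators
open Summit.CriticalPhenomena.Ising3DConformalLimit.Cruxes.ExistsScaleCovariantLimit.MonotoneBlockingPort (blockCov blockCov_zero_pos)

/-- A row sum of two-point functions over sites within sup-distance `R` of `p` is at most the ball sum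
`Σ_{‖z‖_∞ ≤ R} ⟨σ₀σ_z⟩` (reindex by `q ↦ q − p`, an injection into the ball; all terms are `≥ 0`). [folklore] -/
theorem rowSum_le_ballSum (Q : Finset (Site 3)) (p : Site 3) (R : ℕ)
    (hQ : ∀ q ∈ Q, ∀ i, |q i - p i| ≤ R) :
    ∑ q ∈ Q, criticalTwoPoint 3 (q - p) ≤ ∑ z ∈ box 3 R, criticalTwoPoint 3 z := by
  classical
  have hinj : Set.InjOn (fun q : Site 3 => q - p) Q := fun q _ q' _ h => sub_left_injective h
  rw [← Finset.sum_image (f := fun z => criticalTwoPoint 3 z) hinj]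
  refine Finset.sum_le_sum_of_subset_of_nonneg ?_ fun z _ _ => criticalTwoPoint_nonneg' z
  intro z hz
  rw [Finset.mem_image] at hz
  obtain ⟨q, hq, rfl⟩ := hz
  rw [mem_box]
  intro i
  have := hQ q hq i
  rw [abs_le] at this
  exact ⟨by rw [Pi.sub_apply]; exact this.1, by rw [Pi.sub_apply]; exact this.2⟩

/-- **Row sums inside a window.** From `BallSums`: for every `c` there are `A, L₀` such that for `n ≥ L₀`, every site `p`
and every finite set `Q` of sites within sup-distance `2cn` of `p`, `Σ_{q ∈ Q} ⟨σ_pσ_q⟩_{β_c} ≤ A V(n)/n³`. [folklore] -/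
theorem rowSum_window_le (hBS : BallSums) (c : ℕ) :
    ∃ A : ℝ, 0 ≤ A ∧ ∃ L₀ : ℕ, 1 ≤ L₀ ∧ ∀ n : ℕ, L₀ ≤ n → ∀ (Q : Finset (Site 3)) (p : Site 3),
      (∀ q ∈ Q, ∀ i, |q i - p i| ≤ 2 * c * n) →
        ∑ q ∈ Q, criticalTwoPoint 3 (q - p) ≤ A * blockCov n 0 / (n : ℝ) ^ 3 := by
  obtain ⟨A, L₀, hL₀, hA⟩ := hBS (2 * c)
  have hApos : 0 ≤ A := by
    have h := hA L₀ le_rfl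
    have hV : 0 < blockCov L₀ 0 := blockCov_zero_pos L₀ hL₀
    have hS : 0 ≤ (L₀ : ℝ) ^ 3 * ∑ z ∈ box 3 (2 * c * L₀), criticalTwoPoint 3 z :=
      mul_nonneg (by positivity) (Finset.sum_nonneg fun z _ => criticalTwoPoint_nonneg' z)
    nlinarith
  refine ⟨A, hApos, L₀, hL₀, fun n hn Q p hQ => ?_⟩
  have hnpos : (0:ℝ) < n := by exact_mod_cast (show 0 < n by omega)
  have h1 := rowSum_le_ballSum Q p (2 * c * n) (fun q hq i => by exact_mod_cast hQ q hq i)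
  have h2 := hA n hn
  rw [le_div_iff₀ (by positivity)]
  calc (∑ q ∈ Q, criticalTwoPoint 3 (q - p)) * (n:ℝ) ^ 3
      ≤ (∑ z ∈ box 3 (2 * c * n), criticalTwoPoint 3 z) * (n:ℝ) ^ 3 :=
        mul_le_mul_of_nonneg_right h1 (by positivity)
    _ = (n : ℝ) ^ 3 * ∑ z ∈ box 3 (2 * c * n), criticalTwoPoint 3 z := by ring
    _ ≤ A * blockCov n 0 := h2

/-- **Row sums near a point are small.** From `BallSums` (radius `c = 1`) and `TwoPointToolkit` (b): there are `A', L₀` such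
that for `L₀ ≤ L' ≤ n`, every site `p` and every finite `Q` within sup-distance `L'` of `p`,
`Σ_{q∈Q} ⟨σ_pσ_q⟩_{β_c} ≤ A' · (L')^{1/2} · n^{-7/2} · V(n)` (`S(L') ≤ A₁ V(L')/L'³` and `V(L') ≤ A (L'/n)^{7/2} V(n)`). [folklore] -/
theorem rowSum_near_le (hBS : BallSums) (hTK : TwoPointToolkit) :
    ∃ A' : ℝ, 0 ≤ A' ∧ ∃ L₀ : ℕ, 1 ≤ L₀ ∧ ∀ n L' : ℕ, L₀ ≤ L' → L' ≤ n → ∀ (Q : Finset (Site 3)) (p : Site 3),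
      (∀ q ∈ Q, ∀ i, |q i - p i| ≤ L') →
        ∑ q ∈ Q, criticalTwoPoint 3 (q - p) ≤
          A' * ((L' : ℝ) ^ (1 / 2 : ℝ) * (n : ℝ) ^ (-(7 / 2 : ℝ))) * blockCov n 0 := by
  obtain ⟨A₁, hA₁, L₁, hL₁, h₁⟩ := rowSum_window_le hBS 1
  obtain ⟨L₂, hL₂, A, hA, -, hsc⟩ := hTK
  refine ⟨A₁ * A, mul_nonneg hA₁ (by linarith), max L₁ L₂, le_max_of_le_left hL₁, fun n L' hL' hL'n Q p hQ => ?_⟩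
  have hL'1 : L₁ ≤ L' := (le_max_left _ _).trans hL'
  have hL'2 : L₂ ≤ L' := (le_max_right _ _).trans hL'
  have hL'pos : (0:ℝ) < L' := by exact_mod_cast (show 0 < L' by omega)
  have hnpos : (0:ℝ) < n := by exact_mod_cast (show 0 < n by omega)
  -- ball sum at scale `L'`
  have hrow : ∑ q ∈ Q, criticalTwoPoint 3 (q - p) ≤ A₁ * blockCov L' 0 / (L' : ℝ) ^ 3 :=
    h₁ L' hL'1 Q p (fun q hq i => (hQ q hq i).trans (by push_cast; nlinarith))
  -- super-cubic growth between `L'` and `n`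
  have hV : blockCov L' 0 * (n : ℝ) ^ (7 / 2 : ℝ) ≤ A * (L' : ℝ) ^ (7 / 2 : ℝ) * blockCov n 0 := hsc L' n hL'2 hL'n
  have hVn : 0 ≤ blockCov n 0 := (blockCov_zero_pos n (by omega)).le
  -- combine: `A₁ V(L')/L'³ ≤ A₁ A L'^{1/2} n^{-7/2} V(n)`
  have hn72 : (0:ℝ) < (n : ℝ) ^ (7 / 2 : ℝ) := Real.rpow_pos_of_pos hnpos _
  have key : blockCov L' 0 / (L' : ℝ) ^ 3 ≤ A * ((L' : ℝ) ^ (1 / 2 : ℝ) * (n : ℝ) ^ (-(7 / 2 : ℝ))) * blockCov n 0 := by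
    rw [div_le_iff₀ (by positivity)]
    have e1 : (L' : ℝ) ^ (7 / 2 : ℝ) = (L' : ℝ) ^ (1 / 2 : ℝ) * (L' : ℝ) ^ 3 := by
      rw [← Real.rpow_natCast _ 3, ← Real.rpow_add hL'pos]; norm_num
    have e2 : (n : ℝ) ^ (-(7 / 2 : ℝ)) * (n : ℝ) ^ (7 / 2 : ℝ) = 1 := by
      rw [← Real.rpow_add hnpos]; norm_num
    -- multiply `hV` by `n^{-7/2}`
    have hV' : blockCov L' 0 ≤ A * (L' : ℝ) ^ (7 / 2 : ℝ) * blockCov n 0 * (n : ℝ) ^ (-(7 / 2 : ℝ)) := by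
      have := mul_le_mul_of_nonneg_right hV (Real.rpow_nonneg hnpos.le (-(7/2:ℝ)))
      rwa [mul_assoc (blockCov L' 0), mul_comm ((n:ℝ) ^ (7/2:ℝ)), e2, mul_one] at this
    calc blockCov L' 0 ≤ A * (L' : ℝ) ^ (7 / 2 : ℝ) * blockCov n 0 * (n : ℝ) ^ (-(7 / 2 : ℝ)) := hV'
      _ = A * ((L' : ℝ) ^ (1 / 2 : ℝ) * (n : ℝ) ^ (-(7 / 2 : ℝ))) * blockCov n 0 * (L' : ℝ) ^ 3 := by
          rw [e1]; ring
  calc ∑ q ∈ Q, criticalTwoPoint 3 (q - p) ≤ A₁ * blockCov L' 0 / (L' : ℝ) ^ 3 := hrow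
    _ = A₁ * (blockCov L' 0 / (L' : ℝ) ^ 3) := by ring
    _ ≤ A₁ * (A * ((L' : ℝ) ^ (1 / 2 : ℝ) * (n : ℝ) ^ (-(7 / 2 : ℝ))) * blockCov n 0) :=
        mul_le_mul_of_nonneg_left key hA₁
    _ = _ := by ring

/-- **Pair sums inside a window.** With the constants of `rowSum_window_le`: for `n ≥ L₀` and finite sets `Q, Q'` of sites
all of whose mutual coordinate differences are `≤ 2cn`, `Σ_{x∈Q} Σ_{y∈Q'} ⟨σ_xσ_y⟩_{β_c} ≤ |Q| · A V(n)/n³`. [folklore] -/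
theorem pairSum_window_le {A : ℝ} {c n : ℕ}
    (hA : ∀ (Q : Finset (Site 3)) (p : Site 3), (∀ q ∈ Q, ∀ i, |q i - p i| ≤ 2 * c * n) →
      ∑ q ∈ Q, criticalTwoPoint 3 (q - p) ≤ A * blockCov n 0 / (n : ℝ) ^ 3)
    (Q Q' : Finset (Site 3)) (hQQ' : ∀ x ∈ Q, ∀ y ∈ Q', ∀ i, |y i - x i| ≤ 2 * c * n) :
    ∑ x ∈ Q, ∑ y ∈ Q', criticalTwoPoint 3 (y - x) ≤ Q.card * (A * blockCov n 0 / (n : ℝ) ^ 3) := by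
  calc ∑ x ∈ Q, ∑ y ∈ Q', criticalTwoPoint 3 (y - x)
      ≤ ∑ _x ∈ Q, A * blockCov n 0 / (n : ℝ) ^ 3 :=
        Finset.sum_le_sum fun x hx => hA Q' x (fun y hy i => hQQ' x hx y hy i)
    _ = Q.card * (A * blockCov n 0 / (n : ℝ) ^ 3) := by rw [Finset.sum_const, nsmul_eq_mul]

end Summit.CriticalPhenomena.Ising3DConformalLimit.Cruxes.RotationJoining.RateSplitting

end
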